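import Literature.NumberTheory.EllipticCurves.Kobayashi2003.SignedSelmerEtaComponentFacts
import Literature.NumberTheory.EllipticCurves.Kobayashi2003.EtaSignedSelmerDualExistsProofs
import Literature.NumberTheory.EllipticCurves.GreenbergVatsal2000.CongruentCurves
import Literature.NumberTheory.EllipticCurves.SupersingularIrreducibleProofs
import HarnessLib

/-!
# Hatley–Lei 2019, Theorem 4.6 (first claim): for congruent `p`-supersingular curves with `a_p = 0`
# the `μ`-invariant of `Sel^±(E/ℚ(μ_{p^∞}))^θ` vanishes for `E` iff it vanishes for `E'` — on EVERY
# `Δ = Gal(ℚ(μ_p)/ℚ)`-isotypic component `θ` (the `η`-components of Kobayashi's `X^±(E/K_∞)`)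

Topic `Literature/NumberTheory/EllipticCurves`, cluster `HatleyLei2019` (namespace = path). It sits
next to `BDKim2009/SignedSelmerCongruentMuInvariant.lean` (B. D. Kim 2009, Cor. 2.13: the SAME
transfer for the full group `Sel^±(E/ℚ_∞)` over the cyclotomic `ℤ_p`-extension, i.e. the TRIVIAL
component `θ = 1`, named fact `BDKim2009.cor213_signedMu_eq_zero_iff_of_torsionIso`), to
`Kobayashi2003/CyclotomicTowerSignedSelmer.lean` (the OBJECT: Kobayashi's `Sel^ε(E/K_∞)^η` over the
tower `K_∞ = ℚ(μ_{p^∞})` and its Pontryagin-dual hypothesis structure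
`Kobayashi2003.EtaSignedSelmerDualData W κ K₀ E η γ ε`, with `D.mu = muInvariant p D.X` and
`D.charIdeal`), `Kobayashi2003/SignedSelmerEtaComponentFacts.lean` (Thm. 2.2 at `η`: `X^ε(E/K_∞)^η`
finitely generated torsion, named fact `thm22_etaSignedSelmerDual_finite_torsion`),
`Kobayashi2003/EtaSignedSelmerDualExistsProofs.lean` (the datum EXISTS:
`nonempty_etaSignedSelmerDualData_cyclotomic`) and `GreenbergVatsal2000/CongruentCurves.lean`
(the ordinary prototype Thm. (1.4); the vocabulary `HasUnitContent` = "`μ = 0`" read on a generator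
of the characteristic ideal, `muInvariant_eq_zero_iff_hasUnitContent`).

HONEST FRAMING (work item wi-78102, family `bsd`; consumer: cell `bsd-potss`, K8 route
`QuadraticBranchSignedControl`, crux stmt-BirchSwinnertonDyer-19606 `PlusEtaMainConjectureNonsurj`,
files `Summits/BirchSwinnertonDyer/BirchSwinnertonDyer/Theorems/QuadraticBranchSignedControlPlusEtaNonsurjCongruentAnchor.lean`
(p504620) and `…PrimeLFunction*.lean`, whose kernels DISPLAY the transfer as the hypothesis `hHL`):
this file vendors ONE PUBLISHED theorem as a NAMED FACT (`def … : Prop`, statement only, no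
`_holds`; net Literature debt +1), verbatim in the special case the tree's vocabulary reaches
(elliptic curves over `ℚ`, i.e. weight `2` and `E = ℚ_p`; `a_p = 0`; `θ` a `{±1}`-valued character
of `Δ`), on the landed objects; §2 then PROVES, from the fact, the transfer in the exact shape the
consumer displays (`HasUnitContent` of every generator of `Char`, anchor ⟹ target). Nothing about
any curve is asserted; nothing is booked; BSD is not proved by any of this.

## Source, read at the page (held text `paper:arxiv-1608.00257` = arXiv:1608.00257, the AIF
## numbering agrees: Lei–Lim–Müller, AIF (2025) doi:10.5802/aif.3702 cite "[10, Remark 2.5]",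
## "[10, Remark 2.6]", "[10, Lemma 7.1]", "[10, Start of Sec. 7, p. 1289]" with these numbers)

J. Hatley, A. Lei, *Arithmetic properties of signed Selmer groups at non-ordinary primes*, Ann.
Inst. Fourier **69** (2019), no. 3, 1259–1294, doi:10.5802/aif.3270 [HatleyLei2019].

* §1.2 (Notation): "Throughout this article, `p` denotes a fixed odd prime. … Let
  `ℚ_∞ = ℚ(μ_{p^∞})` and `Γ = Gal(ℚ_∞/ℚ) …`, which we decompose as `Γ₀ × Δ`, where `Γ₀ ≅ ℤ_p` and
  `Δ ≅ ℤ/(p−1)ℤ`. … Let `K_∞` be the `ℤ_p`-cyclotomic extension of `ℚ` (so `K_∞ = ℚ_∞^Δ` …). … We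
  write `Λ` for the Iwasawa algebra `𝒪_E⟦Γ₀⟧`, which may be identified with the power series ring
  `𝒪_E⟦X⟧`. … Given a character `θ` on `Δ`, we write `e_θ = (1/(p−1)) ∑_{σ∈Δ} θ(σ)⁻¹·σ` … If `M`
  is an `𝒪_E⟦Γ⟧`-module, we shall write `M^θ = e_θ·M` for its `θ`-isotypic component."
  (CAUTION: Hatley–Lei's `ℚ_∞ = ℚ(μ_{p^∞})` is Kobayashi's `K_∞`, and their `K_∞` is Kobayashi's
  `ℚ_∞`; below we use Kobayashi's / the tree's names.)
* §2.1: "Let `f = ∑ a_n(f)qⁿ` be a normalised new cuspidal modular eigenform of even weight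
  `k ≥ 2`, level `N` and nebentypus `ε` … non-ordinary at `p` … We fix a finite extension `E` of
  `ℚ_p` such that `a_n(f) ∈ E` … `ϖ` a uniformizer … `A_f = V_f/T_f(1)`." Running hypotheses
  (§2.1): "(irred) The `G_ℚ`-representation `T_f/ϖT_f` is irreducible. (inv) For all `m ≥ 0`,
  `A_f(m)^{G_{ℚ_{p,∞}}} = 0`." with "Remark 2.2. … The second hypothesis also holds in many cases.
  For instance, if `k ≤ p` then this follows from the proof of [lei09]."; the signed Selmer groups
  `Sel_i(A_f/ℚ_∞) = ker(H¹(ℚ_∞, A_f) → ∏_v H¹_{/i}(ℚ_{∞,v}, A_f))`, `i = 1, 2` (Coleman maps of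
  Lei–Loeffler–Zerbes 2010 via Wach modules); §2.2: "(tor) Let `θ` be a character on `Δ` and
  `i ∈ {1,2}`. The Selmer group `Sel_i(A_{f,s}/ℚ_∞)^θ` is cotorsion over `Λ`. This is known to hold
  in many cases; see for instance [kobayashi03], [lei09], [leiloefflerzerbes10] and [sprung09]."
* §4: "Given a finitely generated `Λ`-torsion module `M`, we have the pseudo-isomorphism
  `M ∼ ⊕ Λ/ϖ^{n_i} ⊕ ⊕ Λ/F_j^{m_j}` … The `μ`-invariant of `M` is defined to be `∑ n_i` … Since
  `Sel_i(A_f/ℚ_∞)^θ` is `Λ`-cotorsion by (tor), we may define `λ`- and `μ`-invariants for its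
  Pontryagin dual, which we shall refer simply as the `λ`- and `μ`-invariants of `Sel_i(A_f/ℚ_∞)^θ`."
  §4.2: "Let `g = ∑ a_n(g)qⁿ` be a second modular form of weight `k`, level `N′` with `p ∤ N′`. …
  (BLZ) `ord_p(a_p(f)), ord_p(a_p(g)) > ⌊(k−2)/(p−1)⌋`. … From now on, we assume the following
  hypothesis holds for `f` and `g`. (Cong) `T_f/ϖT_f ≅ T_g/ϖT_g` as `G_ℚ`-representations."
* "**Theorem 4.6.** Let `θ ∈ Δ̂` be any character. The `μ`-invariant of `Sel_i(A_{f,s}/ℚ_∞)^θ`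
  vanishes if and only if that of `Sel_i(A_{g,s}/ℚ_∞)^θ` vanishes. In this case, the
  `λ`-invariants of `Sel_i^{Σ₀}(A_{f,s}/ℚ_∞)^θ` and `Sel_i^{Σ₀}(A_{g,s}/ℚ_∞)^θ` coincide."
  (Proof: "the `μ`-invariant of `Sel_i^{Σ₀}(A_{f,s}/ℚ_∞)^θ` vanishes if and only if
  `Sel_i^{Σ₀}(A_{f,s}/ℚ_∞)^θ[ϖ]` is cofinitely generated over `E`. Therefore, the first statement is
  a consequence of Propositions 4.3 and 4.5" — the mod-`ϖ` non-primitive signed Selmer group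
  depends on `T_f/ϖ` only; generalising "[greenbergvatsal] (ordinary case) and [kim09]
  (supersingular case)".)
* §7, table of hypotheses with sufficient conditions: "(inv) … `k ≤ p`", "(tor) … `a_p(f) = 0` or
  `k ≥ 3`", "(BLZ) `ord_p(a_p(f)), ord_p(a_p(g)) > ⌊(k−2)/(p−1)⌋`" (void for `k = 2`), "(cong) …
  Sturm's bound", "(irred) … See Lemma 7.1".

Identification with Kobayashi's objects when `f` is the newform of an elliptic curve `E/ℚ` with
`a_p = 0` (so `k = 2`, `E = ℚ_p`, `𝒪_E = ℤ_p`, `ϖ = p`, `A_f ≅ E[p^∞]`): Lei–Loeffler–Zerbes,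
*Wach modules and Iwasawa theory for modular forms*, Asian J. Math. 14 (2010) [LeiLoefflerZerbes2010],
§1 (held text `paper:arxiv-0912.1263`): "This map has the following property: if `a_p = 0`, then
[the Iwasawa transform] fits into the commutative diagram … where `Col^±` are the Coleman maps
constructed in [kobayashi03] and [lei09]. In other words, if `i = 1, 2` and we define `Col_i` … then
we recover the constructions in op. cit."; §5.3 ("Elliptic curves with `a_p = 0`"): "Then
`V_f(1) = ℚ ⊗ T`, where `T = T_p(E)`. Furthermore, `E[p]` is irreducible as a mod `p` representation
of `G_ℚ`; thus `T` is the unique `G_ℚ`-stable lattice … we may take the lattice `T_f(1)` … to coincide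
with `T`. In this situation, we can recover results of Kobayashi", "the results of Corollaries 5.18
and 5.20 are equivalent to Theorem 6.2 in [kobayashi03]". So `{Sel_1, Sel_2}(A_f/ℚ(μ_{p^∞}))` are
Kobayashi's `{Sel⁺, Sel⁻}(E/K_∞)` (Def. 2.1; the tree's `towerSignedSelmerInfty`, both signs), the
`θ`-component for `θ² = 1` is the tree's `towerSignedSelmerInftyEta … η` (`η : Γ_ℚ →* ℤˣ` trivial on
`Gal(ℚ̄/ℚ(μ_p))`, read on `Δ`; "`M^η` is given by `ε_η M`", Kobayashi §4 p. 8), and "(Cong)" for the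
lattices `T_f(1) = T_p(E)`, `T_g(1) = T_p(E′)` is `E[p](−1) ≅ E′[p](−1)`, i.e. `E[p] ≅ E′[p]` as
`G_ℚ`-modules.

## Transcription (the FIRST claim of Thm. 4.6 only; weight `2`, `a_p = 0`, `θ² = 1`)

* `f`, `g` = the newforms of `W`, `W′/ℚ`, elliptic, globally minimal models (`[W.IsElliptic]`,
  `[W.IsGloballyMinimal]`, so `W.frobeniusTrace p = a_p` and `W.HasGoodReductionAtPrime p` are the
  curve's); "`p` odd" = `p ≠ 2`; "non-ordinary at `p`", `p ∤ N N′`, (BLZ), and the sufficient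
  condition "`a_p(f) = 0`" of (tor) = BOTH curves have good reduction at `p` with `a_p = 0`
  (demanded for both, as §4.2 demands (BLZ) for both; this also puts BOTH Selmer groups in
  Kobayashi's setting, where the tree's object is the paper's by [LeiLoefflerZerbes2010] §5.3);
* (irred) = `W.HasIrreducibleModPGaloisRep p` — DISPLAYED, for both curves (the paper's §7 table
  offers only the numerical criterion Lemma 7.1; for a supersingular `p ≠ 2` it is in fact automatic,
  Serre 1972 §1.11 Prop. 12 = the tree's THEOREM `hasIrreducibleModPGaloisRep_of_dvd_frobeniusTrace`,
  which §2 below uses to discharge it — the fact itself keeps the printed hypothesis);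
* (inv) "`A_f(m)^{G_{ℚ_p(μ_{p^∞})}} = 0` for all `m ≥ 0`" is NOT displayed: the paper itself prints
  its sufficient condition "`k ≤ p`" (Remark 2.2, §7 table), which holds here (`k = 2 < p`); flag
  `HL19-inv-by-table` (a reviewer who wants (inv) displayed needs the tree to carry
  `E(ℚ_p(μ_{p^∞}))[p^∞] = 0`, which it does not — only Sprung 2012 Lemma 2.3 over `ℚ_p·ℚ_∞`);
* (Cong) = a `Γ_ℚ`-equivariant additive isomorphism of the geometric `p`-torsion,
  `∃ e : W.geomTorsion p ≃+ W′.geomTorsion p, ∀ σ P, e (σ • P) = σ • e P` — VERBATIM the spelling of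
  `GreenbergVatsal2000.thm14_mainConjecture_transfer_of_torsionIso`, of
  `BDKim2009.cor213_signedMu_eq_zero_iff_of_torsionIso`, and the BODY of the Summits-side
  abbreviation `Summit.BirchSwinnertonDyer.Rank1Residual.O6.ModPCongruent W W′ p`
  (`Rank1Residual/O6/X4CongruenceAnchor.lean`), so a consumer's `ModPCongruent` hypothesis is this
  binder by `rfl`;
* `ℚ_∞ = ℚ(μ_{p^∞})`, `Γ₀`, `Λ = 𝒪_E⟦Γ₀⟧ = ℤ_p⟦X⟧`, `Δ`, `θ` = Kobayashi's frame exactly as the tree's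
  `Kobayashi2003.thm22_etaSignedSelmerDual_finite_torsion` spells it: `K₀ = ℚ(μ_p)`
  (`IsCyclotomicExtension {p} ℚ K₀`, `Gal(ℚ̄/K₀) = galRange K₀` normal), `η : Γ_ℚ →* ℤˣ` trivial on
  `galRange K₀` (a character of `Δ` with `θ² = 1`: `θ = 1` or `ω^{(p−1)/2}`), `κ` the cyclotomic
  `ℤ_p`-extension of `ℚ` with a topological generator `γ ∈ Gal(ℚ̄/K₀)` of `Γ₀` (`X = γ − 1`; the
  `μ`-invariant does not depend on the choice), the SAME `(K₀, η, κ, γ)` and the same sign `ε` for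
  both curves (`i ↔ ε`: both values on both sides, so the dictionary `Sel_2 = Sel⁺` is not needed);
* "the `μ`-invariant of `Sel_i(A_f/ℚ_∞)^θ`" (:= that of its Pontryagin dual, §4) = `D.mu =
  muInvariant p D.X` for ANY datum `D : EtaSignedSelmerDualData W κ K₀ ℚ_[p] η γ ε` (exists:
  `nonempty_etaSignedSelmerDualData_cyclotomic`), and `D′` for `W′`, which presupposes — as the
  paper does through (tor) and §4 — that the duals are finitely generated `Λ`-torsion: DISPLAYED
  hypotheses `Module.Finite`/`Module.IsTorsion` for `D.X` and `D′.X` (supplied by Kobayashi's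
  Thm. 2.2 at `η`, `thm22_etaSignedSelmerDual_finite_torsion`; for `η² = 1` the two conventions for
  the `Δ`-action on the dual give the same component, `CyclotomicTowerSignedSelmer` §7);
* conclusion: `D.mu = 0 ↔ D′.mu = 0`.

NOT transcribed: the second claim of Thm. 4.6 (equality of the `λ`-invariants of the NON-PRIMITIVE
groups `Sel_i^{Σ₀}(…)^θ`) — the tree has no non-primitive signed Selmer group over the tower; higher
weight `k > 2` / coefficient fields `E ≠ ℚ_p` / `a_p ≠ 0` non-ordinary forms; characters `θ` of `Δ`
of order `∤ 2` (TODO(general form): `θ : Δ → ℤ_p^×` of order dividing `p − 1` needs a `ℤ_p[Δ]`-module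
structure on `H¹` that `CyclotomicTowerSignedSelmer` §6 does not carry); the twists `A_{f,s}`,
`s ≠ 0`.

presearch (PASS step 2, 2026-08-27): `lean search 'HatleyLei|Hatley'` → no declaration (only
docstring mentions in the consumer files and `LambdaInvariantQuadraticTwistAtTwo` = Hatley–RAY 2024);
nearest tree facts = `BDKim2009.cor213_…` (`θ = 1` over `ℚ_∞`, a different object:
`SignedSelmerDualData`) and `GreenbergVatsal2000.thm14_…` (ordinary); corpus: the paper itself
[corpus: paper:arxiv-1608.00257 chunks 11–12, 17] and its citers (AIF 2025 doi:10.5802/aif.3702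
p. 12 "Proposition 3.2 (Hatley–Lei)", arXiv:1912.08430, arXiv:2002.04750) — none restates Thm. 4.6
in another normalisation; galaxy pdf "Hatley|signed Selmer" → 0 relevant hits.

## Contents

* §1 `thm46_etaSignedMu_eq_zero_iff_of_torsionIso` — the NAMED FACT (Thm. 4.6, first claim).
* §2 PROVED consequences in the shape the consumer displays: `mu_eq_zero_transfer_of_thm46` (the
  fact with (irred) discharged by Serre's Prop. 12 — the tree's theorem
  `hasIrreducibleModPGaloisRep_of_dvd_frobeniusTrace` — and (tor) by Kobayashi's Thm. 2.2 at `η`,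
  named fact in hypothesis position `h22`: `D.mu = 0 → D′.mu = 0`);
  `hasUnitContent_transfer_of_thm46` (any sign `ε`, any `θ` with `θ² = 1`, `p ≠ 2`: if every
  `η`-datum of `W` has a characteristic generator of unit content then so does every `η`-datum of
  `W′` — via existence of the datum, principality of `Char` (`charIdeal_isPrincipal_holds`) and
  `μ = 0 ⟺` unit content (`muInvariant_eq_zero_iff_hasUnitContent`)); and
  `plusEtaHasUnitContent_transfer_of_thm46` — the LITERAL binder list of the consumer's `hHL`
  (`5 ≤ p`, `η ≠ 1`, `ε = 1`, `ModPCongruent` unfolded) on the Literature structure. GLUE LEFT TO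
  THE CONSUMER (Summits side, not importable here): its `hHL` is spelled on the Summits ORIGINAL
  structure `Summit.BirchSwinnertonDyer.Rank1Residual.Additive.EtaSignedSelmerDualData` (field for
  field this one); the tree's `rfl`-bridges `Additive.EtaSignedSelmerDualData.toLiterature`
  (`Additive/QuadraticBranchPlusEtaNodes.lean`, `charIdeal_toLiterature`) and
  `PrintReadingsOfLiterature.ofLiterature` (`Theorems/InertBadSignedBranchesPrintReadingsOfLiterature.lean`)
  turn `plusEtaHasUnitContent_transfer_of_thm46 p h46 h22` into that `hHL` in three lines.

References: [HatleyLei2019] Thm. 4.6 (§4.2), §1.2, §2.1 (irred)/(inv) + Remark 2.2, §2.2 (tor), §4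
(the invariants), §4.2 (BLZ)/(Cong), §7 (table of hypotheses, p. 1289); [LeiLoefflerZerbes2010] §1,
§5.2–5.3 (Cor. 5.18, 5.20: `a_p = 0` recovers Kobayashi); [Kobayashi2003] Def. 2.1 (p. 5), Thm. 2.2
(p. 5), §4 p. 8; [BDKim2009] Cor. 2.13 (the `θ = 1` precedent); [GreenbergVatsal2000] Thm. (1.4) and
p. 2 (1)–(2); [Serre1972] §1.11 Prop. 12.
-/

noncomputable section

open scoped Classical

open WeierstrassCurve Field Literature.NumberTheory.EllipticCurves ZpExtension
  Literature.NumberTheory.EllipticCurves.Kobayashi2003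
  Literature.NumberTheory.EllipticCurves.GreenbergVatsal2000

namespace Literature.NumberTheory.EllipticCurves.HatleyLei2019

/-! ## §1 Theorem 4.6, first claim (named fact) -/

/-- **Hatley–Lei 2019, Theorem 4.6 (first claim), for elliptic curves with `a_p = 0`:
`μ(Sel^ε(E/ℚ(μ_{p^∞}))^θ) = 0 ⟺ μ(Sel^ε(E′/ℚ(μ_{p^∞}))^θ) = 0` for congruent curves, on every
`Δ`-isotypic component `θ` with `θ² = 1`.** Ann. Inst. Fourier 69 (2019): "**Theorem 4.6.** Let
`θ ∈ Δ̂` be any character. The `μ`-invariant of `Sel_i(A_{f,s}/ℚ_∞)^θ` vanishes if and only if that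
of `Sel_i(A_{g,s}/ℚ_∞)^θ` vanishes." (`ℚ_∞ = ℚ(μ_{p^∞})`, `Δ = Gal(ℚ(μ_p)/ℚ)`, `M^θ = e_θ·M`, §1.2;
`μ` of the Pontryagin dual over `Λ = 𝒪_E⟦Γ₀⟧`, `Γ₀ = Gal(ℚ_∞/ℚ(μ_p)) ≅ ℤ_p`, §4), under the running
hypotheses: `p` odd (§1.2); `f`, `g` non-ordinary newforms of the same even weight `k ≥ 2`, `p ∤ NN′`
(§2.1, §4.2); (irred) `T_f/ϖT_f` irreducible; (inv) `A_f(m)^{G_{ℚ_p(μ_{p^∞})}} = 0` — sufficient: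
"`k ≤ p`" (Remark 2.2, §7); (tor) `Sel_i(A_{f,s}/ℚ_∞)^θ` cotorsion — sufficient: "`a_p(f) = 0`"
(§7, [kobayashi03]); (BLZ) `ord_p(a_p) > ⌊(k−2)/(p−1)⌋` (void for `k = 2`); (Cong)
`T_f/ϖT_f ≅ T_g/ϖT_g` as `G_ℚ`-representations (§4.2). In the tree's spelling, for the newforms of
two elliptic curves with `a_p = 0` (where `Sel_i(A_f/ℚ(μ_{p^∞}))`, `i = 1, 2`, ARE Kobayashi's
`Sel^±(E/K_∞)` and `T_f(1) = T_p(E)`: Lei–Loeffler–Zerbes 2010 §1 and §5.3): for `W, W′/ℚ` elliptic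
and globally minimal, `p ≠ 2`, BOTH of good reduction at `p` with `a_p(W) = a_p(W′) = 0`, BOTH with
irreducible `E[p]` ((irred), displayed), a `Γ_ℚ`-equivariant additive isomorphism `W[p] ≃ W′[p]`
((Cong)); `K₀ = ℚ(μ_p)`, `η : Γ_ℚ →* ℤˣ` trivial on `Gal(ℚ̄/K₀)` (a character `θ` of `Δ` with
`θ² = 1`), the cyclotomic `ℤ_p`-extension `κ` with a topological generator `γ ∈ Gal(ℚ̄/K₀)`, either
sign `ε`, and ANY Pontryagin-dual data `D` of `Sel^ε(W/K_∞)^η` and `D′` of `Sel^ε(W′/K_∞)^η`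
(`Kobayashi2003.EtaSignedSelmerDualData`, model `ℚ_[p]`) whose modules are finitely generated and
torsion ((tor), displayed; = Kobayashi Thm. 2.2 at `η`): `D.mu = 0 ↔ D′.mu = 0`
(`D.mu = muInvariant p D.X`). The `λ`-claim of Thm. 4.6 (non-primitive groups), weights `k > 2`,
`θ` of order `∤ 2` and the twists `s ≠ 0` are NOT asserted (module docstring); flag
`HL19-inv-by-table` ((inv) taken from the paper's own table, `k = 2 ≤ p`). Statement only; nothing
asserted; no `_holds`.
[cite: HatleyLei2019, Thm. 4.6 (§4.2); §1.2 (notation), §2.1 (irred)/(inv) with Remark 2.2, §2.2 (tor), §4 (μ-invariant), §4.2 (BLZ)/(Cong), §7 table of hypotheses (p. 1289)]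
[cite: LeiLoefflerZerbes2010, §1 and §5.3 (a_p = 0: the Coleman maps and signed Selmer groups are Kobayashi's; T_f(1) = T_p(E))]
[cite: Kobayashi2003, Def. 2.1 (p. 5), Thm. 2.2 (p. 5), §4 p. 8 (the η-components)] -/
def thm46_etaSignedMu_eq_zero_iff_of_torsionIso : Prop :=
  ∀ (W W' : WeierstrassCurve ℚ) [W.IsElliptic] [W.IsGloballyMinimal] [W'.IsElliptic]
      [W'.IsGloballyMinimal] (p : ℕ) [Fact p.Prime],
    p ≠ 2 →
    W.HasGoodReductionAtPrime p → W.frobeniusTrace p = 0 →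
    W'.HasGoodReductionAtPrime p → W'.frobeniusTrace p = 0 →
    W.HasIrreducibleModPGaloisRep p → W'.HasIrreducibleModPGaloisRep p →
    (∃ e : geomTorsion W (p : ℤ) ≃+ geomTorsion W' (p : ℤ),
      ∀ (σ : Field.absoluteGaloisGroup ℚ) (P : geomTorsion W (p : ℤ)), e (σ • P) = σ • e P) →
    ∀ (K₀ : Type) [Field K₀] [NumberField K₀] [IsCyclotomicExtension {p} ℚ K₀]
        [(galRange (K := ℚ) K₀).Normal] (η : absoluteGaloisGroup ℚ →* ℤˣ),
      (∀ σ ∈ galRange (K := ℚ) K₀, η σ = 1) →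
    ∀ (κ : ZpExtension ℚ p) (γ : absoluteGaloisGroup ℚ),
      κ.IsCyclotomic → κ.IsTopGenerator γ → γ ∈ galRange (K := ℚ) K₀ →
    ∀ (ε : ℤˣ) (D : EtaSignedSelmerDualData W κ K₀ ℚ_[p] η γ ε)
        (D' : EtaSignedSelmerDualData W' κ K₀ ℚ_[p] η γ ε),
      Module.Finite (IwasawaAlgebra p) D.X → Module.IsTorsion (IwasawaAlgebra p) D.X →
      Module.Finite (IwasawaAlgebra p) D'.X → Module.IsTorsion (IwasawaAlgebra p) D'.X →
      (D.mu = 0 ↔ D'.mu = 0)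

/-! ## §2 Consequences in the shape the consumer displays (PROVED from the fact) -/

section Consequences

variable {p : ℕ} [Fact p.Prime]

/-- **Thm. 4.6 with (irred) and (tor) discharged: `μ(X^ε(W/K_∞)^η) = 0 ⟹ μ(X^ε(W′/K_∞)^η) = 0`
along `W[p] ≅ W′[p]`** — the named fact (hypothesis `h46`) composed with Kobayashi's Thm. 2.2 at
`η` (named fact `h22`: every datum is finitely generated `Λ`-torsion, = (tor)) and Serre 1972 §1.11
Prop. 12 (= (irred) for both curves; at an odd prime of good reduction with `p ∣ a_p` the module
`E[p]` is irreducible: the tree's THEOREM `hasIrreducibleModPGaloisRep_of_dvd_frobeniusTrace`, with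
`p ∤ Δ_min` from `not_dvd_minimalDiscriminantInt_of_hasGoodReductionAtPrime'`): for `W, W′/ℚ`
globally minimal, `p ≠ 2`, both good at `p` with `a_p = 0`, a `Γ_ℚ`-equivariant `W[p] ≃ W′[p]`,
Kobayashi's frame `(K₀ = ℚ(μ_p), η, κ, γ, ε)` and ANY data `D`, `D′`: `D.mu = 0 → D′.mu = 0` (the
iff of the fact, one direction; the other is the same statement with `W`, `W′` swapped and `e`
inverted). CONDITIONAL on the two named facts.
[cite: HatleyLei2019, Thm. 4.6 (§4.2)] [cite: Kobayashi2003, Thm. 2.2 (p. 5)]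
[cite: Serre1972, §1.11 Prop. 12] -/
theorem mu_eq_zero_transfer_of_thm46 (h46 : thm46_etaSignedMu_eq_zero_iff_of_torsionIso)
    (h22 : thm22_etaSignedSelmerDual_finite_torsion)
    (W W' : WeierstrassCurve ℚ) [W.IsElliptic] [W.IsGloballyMinimal] [W'.IsElliptic]
    [W'.IsGloballyMinimal] (hp2 : p ≠ 2)
    (hgood : W.HasGoodReductionAtPrime p) (hap : W.frobeniusTrace p = 0)
    (hgood' : W'.HasGoodReductionAtPrime p) (hap' : W'.frobeniusTrace p = 0)
    (hiso : ∃ e : geomTorsion W (p : ℤ) ≃+ geomTorsion W' (p : ℤ),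
      ∀ (σ : Field.absoluteGaloisGroup ℚ) (P : geomTorsion W (p : ℤ)), e (σ • P) = σ • e P)
    (K₀ : Type) [Field K₀] [NumberField K₀] [IsCyclotomicExtension {p} ℚ K₀]
    [(galRange (K := ℚ) K₀).Normal] (η : absoluteGaloisGroup ℚ →* ℤˣ)
    (hη : ∀ σ ∈ galRange (K := ℚ) K₀, η σ = 1)
    (κ : ZpExtension ℚ p) (γ : absoluteGaloisGroup ℚ) (hκ : κ.IsCyclotomic)
    (hγ : κ.IsTopGenerator γ) (hγ₀ : γ ∈ galRange (K := ℚ) K₀) (ε : ℤˣ)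
    (D : EtaSignedSelmerDualData W κ K₀ ℚ_[p] η γ ε) (D' : EtaSignedSelmerDualData W' κ K₀ ℚ_[p] η γ ε)
    (hμ : D.mu = 0) : D'.mu = 0 := by
  -- (tor): finite generation and torsion of both duals (Kobayashi, Thm. 2.2 at `η`)
  obtain ⟨hfin, htor⟩ := h22 p K₀ η hη W hp2 hgood hap κ γ hκ hγ hγ₀ ε D
  obtain ⟨hfin', htor'⟩ := h22 p K₀ η hη W' hp2 hgood' hap' κ γ hκ hγ hγ₀ ε D'
  -- (irred) for both curves (Serre, Prop. 12: good ⇒ `p ∤ Δ_min`, and `p ∣ a_p = 0`), then Thm. 4.6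
  have hirr : W.HasIrreducibleModPGaloisRep p :=
    hasIrreducibleModPGaloisRep_of_dvd_frobeniusTrace W p hp2
      (not_dvd_minimalDiscriminantInt_of_hasGoodReductionAtPrime' W p hgood) (hap ▸ dvd_zero _)
  have hirr' : W'.HasIrreducibleModPGaloisRep p :=
    hasIrreducibleModPGaloisRep_of_dvd_frobeniusTrace W' p hp2
      (not_dvd_minimalDiscriminantInt_of_hasGoodReductionAtPrime' W' p hgood') (hap' ▸ dvd_zero _)
  exact (h46 W W' p hp2 hgood hap hgood' hap' hirr hirr' hiso K₀ η hη κ γ hκ hγ hγ₀ ε D D' hfin htor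
    hfin' htor').mp hμ

/-- **Transfer of "`μ = 0`" in Greenberg–Vatsal's reading (2) — unit content of a generator of
`Char` — along `W[p] ≅ W′[p]`, `η`-component by `η`-component, either sign**: in the frame of
`mu_eq_zero_transfer_of_thm46`, IF every `η`-datum `D` of `W` has `HasUnitContent g` for every
generator `g` of `Char(D.X)`, THEN so does every `η`-datum `D′` of `W′`. Proof: a datum `D` for `W`
exists (`nonempty_etaSignedSelmerDualData_cyclotomic`); `Char(D.X)` is principal
(`charIdeal_isPrincipal_holds`), so the hypothesis gives a generator of unit content, i.e. `D.mu = 0`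
(`muInvariant_eq_zero_iff_hasUnitContent`, finiteness/torsion from `h22`);
`mu_eq_zero_transfer_of_thm46` transports `μ = 0` to `D′`; read back on `g′`. CONDITIONAL on the
named facts `h46`, `h22`. [cite: HatleyLei2019, Thm. 4.6 (§4.2)]
[cite: GreenbergVatsal2000, p. 2 (1)–(2)] [cite: Kobayashi2003, Thm. 2.2 (p. 5)] -/
theorem hasUnitContent_transfer_of_thm46 (h46 : thm46_etaSignedMu_eq_zero_iff_of_torsionIso)
    (h22 : thm22_etaSignedSelmerDual_finite_torsion)
    (W W' : WeierstrassCurve ℚ) [W.IsElliptic] [W.IsGloballyMinimal] [W'.IsElliptic]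
    [W'.IsGloballyMinimal] (hp2 : p ≠ 2)
    (hgood : W.HasGoodReductionAtPrime p) (hap : W.frobeniusTrace p = 0)
    (hgood' : W'.HasGoodReductionAtPrime p) (hap' : W'.frobeniusTrace p = 0)
    (hiso : ∃ e : geomTorsion W (p : ℤ) ≃+ geomTorsion W' (p : ℤ),
      ∀ (σ : Field.absoluteGaloisGroup ℚ) (P : geomTorsion W (p : ℤ)), e (σ • P) = σ • e P)
    (K₀ : Type) [Field K₀] [NumberField K₀] [IsCyclotomicExtension {p} ℚ K₀]
    [(galRange (K := ℚ) K₀).Normal] (η : absoluteGaloisGroup ℚ →* ℤˣ)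
    (hη : ∀ σ ∈ galRange (K := ℚ) K₀, η σ = 1)
    (κ : ZpExtension ℚ p) (γ : absoluteGaloisGroup ℚ) (hκ : κ.IsCyclotomic)
    (hγ : κ.IsTopGenerator γ) (hγ₀ : γ ∈ galRange (K := ℚ) K₀) (ε : ℤˣ)
    (hμ : ∀ (D : EtaSignedSelmerDualData W κ K₀ ℚ_[p] η γ ε) (g : IwasawaAlgebra p),
      D.charIdeal = Ideal.span {g} → HasUnitContent g)
    (D' : EtaSignedSelmerDualData W' κ K₀ ℚ_[p] η γ ε) (g' : IwasawaAlgebra p)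
    (hg' : D'.charIdeal = Ideal.span {g'}) : HasUnitContent g' := by
  -- a dual datum for `W` exists, and its characteristic ideal is principal
  obtain ⟨D⟩ := nonempty_etaSignedSelmerDualData_cyclotomic W κ K₀ ℚ_[p] η ε hγ hγ₀
  haveI : (EllipticCurves.Module.charIdeal (IwasawaAlgebra p) D.X).IsPrincipal :=
    charIdeal_isPrincipal_holds p D.X
  obtain ⟨g, hg⟩ :=
    Submodule.IsPrincipal.principal (EllipticCurves.Module.charIdeal (IwasawaAlgebra p) D.X)
  have hgD : D.charIdeal = Ideal.span {g} := hg
  -- (tor): finite generation and torsion of both duals (Kobayashi, Thm. 2.2 at `η`)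
  obtain ⟨hfin, htor⟩ := h22 p K₀ η hη W hp2 hgood hap κ γ hκ hγ hγ₀ ε D
  obtain ⟨hfin', htor'⟩ := h22 p K₀ η hη W' hp2 hgood' hap' κ γ hκ hγ hγ₀ ε D'
  -- `μ(D) = 0` from the unit content of `g`, transported by Thm. 4.6, read back on `g'`
  have hμD : D.mu = 0 := (muInvariant_eq_zero_iff_hasUnitContent D.X htor hgD).mpr (hμ D g hgD)
  have hμD' : D'.mu = 0 :=
    mu_eq_zero_transfer_of_thm46 h46 h22 W W' hp2 hgood hap hgood' hap' hiso K₀ η hη κ γ hκ hγ hγ₀ ε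
      D D' hμD
  exact (muInvariant_eq_zero_iff_hasUnitContent D'.X htor' hg').mp hμD'

variable (p) in
/-- **The consumer's displayed transfer `hHL`, LITERALLY** (route `QuadraticBranchSignedControl`,
crux 19606, `…PlusEtaNonsurjCongruentAnchor.lean`: `EtaCongruentAnchor.etaMu_of_modPCongruent` and
its siblings take this binder list as the hypothesis `hHL`): for `V′, V/ℚ` globally minimal elliptic,
`5 ≤ p`, both good at `p` with `a_p = 0`, `V′[p] ≅ V[p]` (the body of the Summits-side
`Rank1Residual.O6.ModPCongruent V′ V p`, unfolded — a Literature file imports no `Summits` module;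
the consumer's hypothesis matches by `rfl`), IF for every `K₀ = ℚ(μ_p)`, every NON-TRIVIAL
`{±1}`-valued `ηq` of `Δ`, every cyclotomic `(κ, γ)` with `γ ∈ Gal(ℚ̄/K₀)`, every PLUS datum `D` of
`V′` and every generator `g` of `Char(D.X)` one has `HasUnitContent g` ("`μ(X⁺(V′/K_∞)^η) = 0`"),
THEN the same holds for `V`. Specialisation of `hasUnitContent_transfer_of_thm46` (`p ≠ 2` from
`5 ≤ p`, `ε = 1`); CONDITIONAL on the two named facts `h46` (Hatley–Lei Thm. 4.6) and `h22`
(Kobayashi Thm. 2.2 at `η`), both of which the consumer already threads.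
[cite: HatleyLei2019, Thm. 4.6 (§4.2)] [cite: Kobayashi2003, Thm. 2.2 (p. 5), §4 p. 8] -/
theorem plusEtaHasUnitContent_transfer_of_thm46
    (h46 : thm46_etaSignedMu_eq_zero_iff_of_torsionIso)
    (h22 : thm22_etaSignedSelmerDual_finite_torsion) :
    ∀ (V' : WeierstrassCurve ℚ) [V'.IsElliptic] [V'.IsGloballyMinimal]
        (V : WeierstrassCurve ℚ) [V.IsElliptic] [V.IsGloballyMinimal],
        5 ≤ p → V'.HasGoodReductionAtPrime p → V'.frobeniusTrace p = 0 →
        V.HasGoodReductionAtPrime p → V.frobeniusTrace p = 0 →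
        (∃ e : V'.geomTorsion (p : ℤ) ≃+ V.geomTorsion (p : ℤ),
          ∀ (σ : Field.absoluteGaloisGroup ℚ) (P : V'.geomTorsion (p : ℤ)),
            e (σ • P) = σ • e P) →
      (∀ (K₀ : Type) [Field K₀] [NumberField K₀] [IsCyclotomicExtension {p} ℚ K₀]
          [(galRange (K := ℚ) K₀).Normal] (ηq : absoluteGaloisGroup ℚ →* ℤˣ),
          (∀ σ ∈ galRange (K := ℚ) K₀, ηq σ = 1) → ηq ≠ 1 →
        ∀ (κ : ZpExtension ℚ p) (γ : absoluteGaloisGroup ℚ),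
          κ.IsCyclotomic → κ.IsTopGenerator γ → γ ∈ galRange (K := ℚ) K₀ →
        ∀ (D : EtaSignedSelmerDualData V' κ K₀ ℚ_[p] ηq γ 1) (g : IwasawaAlgebra p),
          D.charIdeal = Ideal.span {g} → HasUnitContent g) →
      (∀ (K₀ : Type) [Field K₀] [NumberField K₀] [IsCyclotomicExtension {p} ℚ K₀]
          [(galRange (K := ℚ) K₀).Normal] (ηq : absoluteGaloisGroup ℚ →* ℤˣ),
          (∀ σ ∈ galRange (K := ℚ) K₀, ηq σ = 1) → ηq ≠ 1 →
        ∀ (κ : ZpExtension ℚ p) (γ : absoluteGaloisGroup ℚ),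
          κ.IsCyclotomic → κ.IsTopGenerator γ → γ ∈ galRange (K := ℚ) K₀ →
        ∀ (D : EtaSignedSelmerDualData V κ K₀ ℚ_[p] ηq γ 1) (g : IwasawaAlgebra p),
          D.charIdeal = Ideal.span {g} → HasUnitContent g) := by
  intro V' _ _ V _ _ hp5 hgood' hap' hgood hap hcong hμ' K₀ _ _ _ _ ηq hηq hne κ γ hκ hγ hγ₀ D g hg
  have hp2 : p ≠ 2 := by omega
  exact hasUnitContent_transfer_of_thm46 h46 h22 V' V hp2 hgood' hap' hgood hap hcong K₀ ηq hηq κ γ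
    hκ hγ hγ₀ 1 (hμ' K₀ ηq hηq hne κ γ hκ hγ hγ₀) D g hg

end Consequences

end Literature.NumberTheory.EllipticCurves.HatleyLei2019

end

/-!
## Addendum (doc-only, 2026-08-27, cell `bsd-print-x8` seat ty1 g3): why the `a_p ≠ 0` (♯/♭) case of
## Thm. 4.6 is NOT transcribed on Sprung's objects — read at the page

The «NOT transcribed: … `a_p ≠ 0` non-ordinary forms» line of the module docstring is DELIBERATE and
must stay: at `k = 2`, `p = 3`, `a_3 = ±3` (leaf `ClassX8`) Theorem 4.6 does not reach the tree's ♯/♭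
object `Sprung2012.SharpFlatSelmerDualData` (Sprung, J. Number Theory 132 (2012), Def. 7.9/7.11: the
exact annihilators of `Ker Col^{♯/♭}` for the Honda-theoretic Coleman map of Def. 5.9) for two
independent printed reasons; no declaration is added or changed by this addendum.

* (O1) OBJECT. `Sel_i(A_f/ℚ(μ_{p^∞}))` of §2.1 is built from the Wach-module basis `n_1, n_2`
  («We shall choose `n_1, n_2` so that `ν_1` is an `𝒪_E`-basis of `Fil⁰ 𝔻_cris(T_f)` and
  `φ(ν_1) = ν_2`», §2.1) through the Lei–Loeffler–Zerbes Coleman maps `Col_{f,i}`. The only printed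
  comparison with Sprung's pair is Lei–Loeffler–Zerbes, Asian J. Math. 14 (2010) §5.4 («The case
  `k = 2`»), §5.4.2: «Hence, there exists `A ∈ GL₂(Λ_E(G_∞))`, `M A_∞^{−1} = [log_p(γ)/(p(γ−1))]A`.
  This implies `(Col_1 Col_2)A = (Col^♯∘h¹, Col^♭∘h¹)`. We also see that `M` and `(A_∞^{−1})^c` agree
  up to an element in `GL₂(Λ_E(G_∞))`» — the two PAIRS agree up to a matrix in `GL₂(Λ)`, which is
  not printed to be diagonal, so `Ker Col_i = Ker Col^{♯/♭}` (hence `Sel_i = Sel^{♯/♭}`) is NOT in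
  print for `a_p ≠ 0` (contrast §5.3, Cor. 5.18/5.20, which print `Sel_i = Sel^±` at `a_p = 0` — the
  case transcribed above). Sprung 2012 itself (pp. 1484–1485) calls [LLZ] «one generalization» whose
  `L`-functions live in «`ℤ_p[[X]] ⊗ ℚ`» and asks whether «these matrices could be expressed
  explicitly»; no identification is claimed there either.
* (O2) HYPOTHESIS (tor). §7, table of hypotheses (p. 1289): «(tor) `Sel_i(A_{f,s}/ℚ_∞)^θ` is
  cotorsion over `Λ` — Sufficient Conditions: `a_p(f) = 0` or `k ≥ 3`», and on the same page: «It is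
  also interesting to test which of the above hypotheses are really necessary; for instance,
  computational experiments suggest that the theorem still holds when `k = 2` and `a_p(f) ≠ 0`, which
  suggests that (tor) also holds in this setting.» So at `(k, p, a_p) = (2, 3, ±3)` the authors
  themselves regard (tor) for `Sel_i` as not established (Sprung's Thm. 7.14 is cotorsion of HIS
  `X^{♯/♭}`, which by (O1) is not `Sel_i`); a transcription would have to DISPLAY (tor) for an object
  the tree does not carry.

Consequently a `[cite: HatleyLei2019, Thm. 4.6]` fact on `SharpFlatSelmerDualData` would assert (O1)
and (O2) silently, i.e. be stronger than print. The preprint version for the Büyükboduk–Lei/LLZ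
logarithmic-matrix `Sel^♮` (Corpuz–Lei, arXiv:2508.09733, Thm. 5.9: «The assertion on the
`μ`-invariants follows from [HL19]») is carried Summits-side as an explicitly OPEN binder, not here.
What IS in print, basis-free and colour-free, for the `μ`-part at `(3, ±3)`: Coates–Sujatha's
statement (A) is an invariant of `E[p]` — Lim–Sujatha, J. Number Theory 187 (2018) Prop. 3.2, the
tree's THEOREM `LimSujatha2018.prop32_fineSelmerDual_moduleFinite_iff_of_torsionIso_holds`
(`FineSelmerCongruentCurves.lean`) — which, composed with Sprung 2012 Prop. 7.19 at `η = 1`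
(«`0 → 𝐇¹(T)/𝐙(T) → Λ/(L^•_p(E,X)) → X^•(E/ℚ_∞) → X^0(E/ℚ_∞) → 0`» for `L^• ≠ 0`, p. 1505), bounds
`μ(X^•) ≤ μ(Λ/(L^•)) + μ(X^0)` and transfers `μ(X^0) = 0` along a congruence. A Kim-2009-style ♯/♭
argument is obstructed by Sprung 2012, Open Problem 7.22 (no trace-map description of
`E^{♯/♭}(K_{n,p})`). Dossier: `run/shared/lean/pub/bsd-print-x8/TY1-VERDICT-HL19-SHARPFLAT-AT-THE-PAGE.md`.

References: [HatleyLei2019] §2.1, §7 (table and the sentence after Lemma 7.1, p. 1289);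
[LeiLoefflerZerbes2010] §5.3 (Cor. 5.18, 5.20), §5.4.1–5.4.2 (Lemma 5.23, Prop. 5.24, Def. 5.25,
Lemma 5.27, Cor. 5.28 and the paragraph following it); [Sprung2012] pp. 1484–1485, Def. 5.9, 7.9,
7.11, Thm. 7.14, Prop. 7.19 (p. 1505), Open Problem 7.22; [LimSujatha2018] §3 Prop. 3.2;
[CorpuzLei2025] §5 Def. 5.4, Remark 5.5, Thm. 5.9.
-/
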